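import Summits.QuantumFields.YangMills.Theorems.BalabanUVNodesN07AveragingLocalContinuity
import Summits.QuantumFields.YangMills.Theorems.BalabanUVNodesN11LocalIteratedAveraging
import Literature.MathematicalPhysics.QuantumFieldTheory.Balaban1983to89.BlockAveragingPlaquetteBoundLocal
import Literature.MathematicalPhysics.QuantumFieldTheory.Balaban1983to89.Node00.MultiScaleFibreChart
import HarnessLib

/-!
# BalabanUVNodes ∕ N12 — THE CLASS LETTER OF THE w1 LINEAGE's CHART THEOREM, PART 1: CONTINUITY OF THE AVERAGING OF RECORD IN THE CONFIGURATION
# DOWN THE BLOCK TOWER UNDER A CONSTRAINED BOND, AND THE (0.4) GUARDS THERE FROM THE LOCAL [B7] PROPOSITION 2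
# ([Balaban1987RG1] (0.4) p. 253 «we assume that it is an analytic function»; [Balaban1985Variational] (2), (7) pp. 278–279 «Ū^j ∈ U_{k−j}(…, O(1)ε₀)»;
# [Balaban1985Averaging] Prop. 2 (52)–(54) p. 26 «the result is local»)

Cell `pub-ymgap` (HUMAN RULINGS D-0062 ∕ D-0149), WIDTH SEAT `pub-ymgap-dag-n12-w1` g4 (node N12 = [B15]; key K1⁹ `stmt-QuantumFields-27364`, `--kind proof --supports … --as helper`;
count-neutral).  THEOREMS ONLY (0 `def`, 0 `instance`, 0 `sorry`); consumed BY NAME: dag-n07-e's one-bond continuity brick `…N07AveragingLocalContinuity.continuousAt_iter_succ_apply_of_small_of_local`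
(module 16, whose header defers exactly this composition: «iterated down the tower under a bond, with the smallness supplied … by the LOCAL Proposition 2 — not composed here»),
dag-n11-d's LOCAL `k`-uniform [B7] Prop. 2 `…N11LocalIteratedAveraging.plaqSmallOn_iter_avOfRecord_of_boxClosed`, and the tree's `BlockAveragingPlaquetteBoundLocal.small_of_plaqSmallOn_blocks`.

WHY.  The w1 lineage's chart theorems (`B15Prop1MinimiserFamilyFromThm1AtBaseCentral.hMin_atRecord_of_node00Letters_thm1AtBase_central`, p631475, and its (45)-discharged edition
`…N12RightInverseLetterOfForest.…_central_surj`, p633254) display, besides print's per-base-field letters, three CLASS letters about a closed reading class `reg'` of NODE 00's (2.12)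
class: `IsClosed reg'`, `closure (regMSCoPOfRecord …) ⊆ reg'`, and `hDreg' : ContinuousOn (fun U i => ↑(Ū U)_{(j_i,c_i)}) reg'` — the `𝐁`-restricted multi-scale averages are continuous
on `reg'`.  The third is NOT a formality: the averaging of record `blockAvg expMeanLogSU` is a total map extended by `1` off the (0.4) small-field guard and is DISCONTINUOUS there
(`BlockAveragingExpMeanLogContinuous`, header).  It is continuous in the configuration at `U₀` exactly where the guard holds down the block tower under the bond — THIS FILE, §1–§2 —
and the guard down the tower follows from print's regularity propagation [15] (7) ∕ [B7] Prop. 2 in its printed LOCAL form, which dag-n11-d typed for the averaging of record on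
box-closed plaquette families — §3.  Part 2 (`…N12ClassLettersAtClosedClassOfRecord`) feeds §3 from the closed (≤) reading of NODE 00's class and packages the three letters.

CONTENTS.
* §1 ★ `continuousAt_iter_apply_of_small_on_closedBelow` — TOWER CONTINUITY: for a bond family `B = (B_i)` closed downward under the (0.4) window below level `k` and a configuration
  `U₀` whose iterates carry the guard `Small ℰp (Ū^i U₀) c` at every `c ∈ B_{i+1}`, `i + 1 ≤ k`, EVERY tower variable `U ↦ Ū^i(U)(b)`, `i ≤ k`, `b ∈ B_i`, is continuous at `U₀`
  (induction on the level over dag-n07-e's brick); `continuousAt_iter_apply_of_smallBelow` — the global guard inhabits the hypotheses.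
* §2 ★★ `continuousOn_iter_apply_of_towerGuards`, ★★ `continuousOn_constrainedAverages_of_towerGuards` — `ContinuousOn` on ANY set `R` each of whose points carries such a tower (of
  height = the bond's level) under the bond, resp. under every constrained bond of a determining set `𝐁` up to level `k`; the second is VERBATIM the shape of the letter `hDreg'`
  (index `Fin (constrCard 𝐁 k)`, matrix values).
* §3 ★★ `small_iter_of_plaqSmallOn_boxClosed` — TOWER GUARDS from dag-n11-d's local Prop. 2: a box-closed plaquette family `S` containing the three blocks `B(c₋ − e_μ) ∪ B(c₋) ∪ B(c₊)`
  of every tower bond, `|U(∂p) − 1| < α₀η_k²` on `S 0`, and the numerics `C₀(d)α₀ ≤ ⅓`, `2α₀ ≤ c′₂` give the guard at every tower bond (the guard radius inequality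
  `(((d+2)L)²∕4)·2α₀ < δ_N` FOLLOWS from `2α₀ ≤ c′₂`, `stokes_two_mul_lt_deltaSU`); ★★★ `continuousAt_iter_apply_of_plaqSmallOn_boxClosed` — §1 ∘ §3.

HONEST FRAMING.  Kernel continuity∕bookkeeping over the tree's own averaging and dag-n11-d's kernel theorem ([B7] Prop. 2 local, proved in the tree); the box-closed ∕ window-closed
families and the fine plaquette bound are DISPLAYED hypotheses (Part 2 inhabits the bound from the class; the families are a combinatorial letter there); nothing of Bałaban's
estimates asserted; N12 NOT discharged; K1⁹ NOT closed; counts unmoved; one finite 𝕋⁴ programme at fixed ε — R4 closes the conditional rung `BalabanLadder.UV` only; the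
Yang–Mills mass gap (Clay) is NOT proved by any of this; nothing continuum ∕ ℝ⁴ ∕ OS.
-/

noncomputable section

namespace Summit.QuantumFields.YangMills.BalabanUVNodes.N12ClassLetterTowerContinuity

open Set Filter Topology
open Literature.MathematicalPhysics.QuantumFieldTheory.Balaban1983to89
open Literature.MathematicalPhysics.QuantumFieldTheory.Balaban1983to89.T4Continuum (T4Family)
open Literature.MathematicalPhysics.QuantumFieldTheory.Balaban1983to89.Node00
open Literature.MathematicalPhysics.QuantumFieldTheory.Balaban1983to89.BlockAveraging (blockAvg Small)
open Literature.MathematicalPhysics.QuantumFieldTheory.Balaban1983to89.ExpMeanLog (expMeanLogSU deltaSU)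
open Literature.MathematicalPhysics.QuantumFieldTheory.Balaban1983to89.B15DeterminingSets (DetSet MSField avgFamily bondsOf)
open Summit.QuantumFields.YangMills.BalabanUVNodes.N07AveragingLocalContinuity (continuousAt_iter_zero_apply continuousAt_iter_succ_apply_of_small_of_local)
open Summit.QuantumFields.YangMills.Theorems.BalabanUVNodesN11LocalIteratedAveraging (plaqSmallOn_iter_avOfRecord_of_boxClosed)
open Summit.QuantumFields.YangMills.BalabanUVNodes.N20LCSAvgDominationRegion (boxRegion)
open Literature.MathematicalPhysics.QuantumFieldTheory.Balaban1983to89.BlockAveragingPlaquetteBoundLocal (small_of_plaqSmallOn_blocks)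
open scoped Matrix.Norms.L2Operator

variable {F : T4Family} {N : ℕ} [NeZero N] {K : ℕ}

/-! ## §1  Tower continuity under a support-localised guard -/

/-- ★ **TOWER CONTINUITY OF THE AVERAGING OF RECORD IN THE CONFIGURATION.**  Let `B = (B_i)` be a family of bond sets CLOSED DOWNWARD under the (0.4) window below level `k`
(`c ∈ B_{i+1}`, `blockOf b₋ ∈ {c₋, c₊}` ⇒ `b ∈ B_i`), `k` in the standing range, and let the iterates of `U₀` carry the (0.4) guard at every `c ∈ B_{i+1}`, `i + 1 ≤ k`.  Then every
tower variable `U ↦ Ū^i(U)(b)`, `i ≤ k`, `b ∈ B_i`, is continuous at `U₀` — dag-n07-e's one-bond brick iterated down the tower (the «holes-version» its module 16 defers).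
[cite: Balaban1987RG1, (0.4), (0.11) p.253; Balaban1985Variational, (2) p.278; Balaban1985Averaging, p.24 (locality)] -/
theorem continuousAt_iter_apply_of_small_on_closedBelow {k : ℕ} (hk : k ≤ (F.P K).m + (F.P K).K) {U₀ : GaugeField (F.P K) 0 (SU N)}
    (B : (i : ℕ) → Set (PBond (F.P K) i))
    (hB : ∀ (i : ℕ) (c : PBond (F.P K) (i + 1)), i + 1 ≤ k → c ∈ B (i + 1) →
      ∀ b : PBond (F.P K) i, (blockOf b.src = c.src ∨ blockOf b.src = c.tgt) → b ∈ B i)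
    (hg : ∀ (i : ℕ) (c : PBond (F.P K) (i + 1)), i + 1 ≤ k → c ∈ B (i + 1) →
      Small (expMeanLogSU (n := Fin N)) (Averaging.iter (avOfRecord F N K) i U₀) c) :
    ∀ i, i ≤ k → ∀ b ∈ B i, ContinuousAt (fun U : GaugeField (F.P K) 0 (SU N) => Averaging.iter (avOfRecord F N K) i U b) U₀
  | 0, _, b, _ => continuousAt_iter_zero_apply K U₀ b
  | i + 1, hi, c, hc =>
    continuousAt_iter_succ_apply_of_small_of_local K i (hi.trans hk) c (hg i c hi hc) fun b hb =>
      continuousAt_iter_apply_of_small_on_closedBelow hk B hB hg i (Nat.le_of_succ_le hi) b (hB i c hi hc b hb)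

/-- **THE GLOBAL GUARD INHABITS §1** (`B ≡ univ`): under `SmallBelow (avOfRecord F N K) k U₀` every `U ↦ Ū^i(U)(b)`, `i ≤ k`, is continuous at `U₀` — the configuration-space
twin of `Node00.AveragingSmooth`'s chart-direction smoothness. [cite: Balaban1987RG1, (0.4) p.253, (0.21) p.256] -/
theorem continuousAt_iter_apply_of_smallBelow {k : ℕ} (hk : k ≤ (F.P K).m + (F.P K).K) {U₀ : GaugeField (F.P K) 0 (SU N)}
    (hsb : SmallBelow (avOfRecord F N K) k U₀) {i : ℕ} (hi : i ≤ k) (b : PBond (F.P K) i) :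
    ContinuousAt (fun U : GaugeField (F.P K) 0 (SU N) => Averaging.iter (avOfRecord F N K) i U b) U₀ :=
  continuousAt_iter_apply_of_small_on_closedBelow hk (fun _ => Set.univ) (fun _ _ _ _ _ _ => Set.mem_univ _)
    (fun i c hi _ => hsb i hi c) i hi b (Set.mem_univ b)

/-! ## §2  `ContinuousOn` on a set each of whose points carries a guarded tower -/

/-- ★★ **CONTINUITY ON A CLASS, ONE BOND**: if every `U₀ ∈ R` carries a bond family through `c` (level `j`, standing range) closed downward under the (0.4) window BELOW `j` on
which its iterates are guarded BELOW `j`, then `U ↦ Ū^j(U)(c)` is continuous ON `R` (indeed continuous AT every point of `R`) — §1 at height `j`.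
[cite: Balaban1985Variational, (2), (7) pp.278–279; Balaban1987RG1, (0.4) p.253] -/
theorem continuousOn_iter_apply_of_towerGuards {j : ℕ} (hj : j ≤ (F.P K).m + (F.P K).K) (R : Set (GaugeField (F.P K) 0 (SU N)))
    (c : PBond (F.P K) j)
    (htower : ∀ U₀ ∈ R, ∃ B : (i : ℕ) → Set (PBond (F.P K) i), c ∈ B j ∧
      (∀ (i : ℕ) (c' : PBond (F.P K) (i + 1)), i + 1 ≤ j → c' ∈ B (i + 1) →
        ∀ b : PBond (F.P K) i, (blockOf b.src = c'.src ∨ blockOf b.src = c'.tgt) → b ∈ B i) ∧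
      (∀ (i : ℕ) (c' : PBond (F.P K) (i + 1)), i + 1 ≤ j → c' ∈ B (i + 1) →
        Small (expMeanLogSU (n := Fin N)) (Averaging.iter (avOfRecord F N K) i U₀) c')) :
    ContinuousOn (fun U : GaugeField (F.P K) 0 (SU N) => Averaging.iter (avOfRecord F N K) j U c) R := fun U₀ hU₀ => by
  obtain ⟨B, hc, hB, hg⟩ := htower U₀ hU₀
  exact (continuousAt_iter_apply_of_small_on_closedBelow hj B hB hg j le_rfl c hc).continuousWithinAt

/-- ★★ **THE SHAPE OF THE CLASS LETTER `hDreg'`**: for a determining set `𝐁`, a top level `k` in the standing range, and a set `R` of configurations each of which carries,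
under EVERY constrained bond `(j, c)` of `𝐁` with `j ≤ k`, a bond family through `c` closed downward under the (0.4) window below `j` and guarded below `j`, the `𝐁`-restricted
averages `U ↦ (↑(Ū^{j_i}(U)(c_i)))_{i < #constraints}` (matrix values, NODE 00's enumeration `constrEnum`) are continuous ON `R` — verbatim the hypothesis `hDreg'` of
`B15Prop1MinimiserFamilyFromThm1AtBaseCentral.hMin_atRecord_of_node00Letters_thm1AtBase_central` at `reg' := R`.
[cite: Balaban1985Variational, (2), (7) pp.278–279, (16)–(18) p.280; Balaban1988Convergent, (2.10)–(2.12) p.256] -/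
theorem continuousOn_constrainedAverages_of_towerGuards {k : ℕ} (hk : k ≤ (F.P K).m + (F.P K).K) (𝔹 : DetSet (F.P K))
    (R : Set (GaugeField (F.P K) 0 (SU N)))
    (htower : ∀ U₀ ∈ R, ∀ j, j ≤ k → ∀ c ∈ bondsOf (𝔹 j), ∃ B : (i : ℕ) → Set (PBond (F.P K) i), c ∈ B j ∧
      (∀ (i : ℕ) (c' : PBond (F.P K) (i + 1)), i + 1 ≤ j → c' ∈ B (i + 1) →
        ∀ b : PBond (F.P K) i, (blockOf b.src = c'.src ∨ blockOf b.src = c'.tgt) → b ∈ B i) ∧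
      (∀ (i : ℕ) (c' : PBond (F.P K) (i + 1)), i + 1 ≤ j → c' ∈ B (i + 1) →
        Small (expMeanLogSU (n := Fin N)) (Averaging.iter (avOfRecord F N K) i U₀) c')) :
    ContinuousOn (fun (U : GaugeField (F.P K) 0 (SU N)) (i : Fin (constrCard 𝔹 k)) =>
      ((avgFamily (avOfRecord F N K) U ((constrEnum 𝔹 k).symm i).1 ((constrEnum 𝔹 k).symm i).2.1 : SU N) : Matrix (Fin N) (Fin N) ℂ)) R := by
  refine continuousOn_pi.2 fun i => ?_
  have hj : (((constrEnum 𝔹 k).symm i).1 : ℕ) ≤ k := Nat.lt_succ_iff.mp ((constrEnum 𝔹 k).symm i).1.2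
  have h := continuousOn_iter_apply_of_towerGuards (hj.trans hk) R ((constrEnum 𝔹 k).symm i).2.1
    fun U₀ hU₀ => htower U₀ hU₀ _ hj _ ((constrEnum 𝔹 k).symm i).2.2
  exact continuous_subtype_val.comp_continuousOn h

/-! ## §3  The guards down the tower from the LOCAL [B7] Proposition 2 on a box-closed plaquette family -/

omit [NeZero N] in
/-- Arithmetic: `2α₀ ≤ c′₂ = 2δ_N∕((d+4)L)²` gives the guard-radius inequality `(((d+2)L)²∕4)·(2α₀) < δ_N` of `small_of_plaqSmallOn_blocks` (`0 < α₀`, `1 ≤ L`). [folklore] -/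
theorem stokes_two_mul_lt_deltaSU {α₀ : ℝ} (hα : 0 < α₀)
    (hα2 : 2 * α₀ ≤ 2 * deltaSU (Fin N) / ((((F.P K).d + 4) * (F.P K).L : ℕ) : ℝ) ^ 2) :
    (((((F.P K).d + 2) * (F.P K).L : ℕ) : ℝ) ^ 2 / 4) * (2 * α₀) < deltaSU (Fin N) := by
  have hDpos : (0 : ℝ) < ((((F.P K).d + 4) * (F.P K).L : ℕ) : ℝ) :=
    Nat.cast_pos.mpr (Nat.mul_pos (Nat.succ_pos _) (F.P K).L_pos)
  have hD : (0 : ℝ) < ((((F.P K).d + 4) * (F.P K).L : ℕ) : ℝ) ^ 2 := by positivity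
  have h1 : α₀ * ((((F.P K).d + 4) * (F.P K).L : ℕ) : ℝ) ^ 2 ≤ deltaSU (Fin N) := by
    have h : α₀ ≤ deltaSU (Fin N) / ((((F.P K).d + 4) * (F.P K).L : ℕ) : ℝ) ^ 2 := by
      rw [mul_div_assoc] at hα2
      linarith
    rwa [le_div_iff₀ hD] at h
  have h2 : (((((F.P K).d + 2) * (F.P K).L : ℕ) : ℝ) ^ 2 / 4) * (2 * α₀) < α₀ * ((((F.P K).d + 4) * (F.P K).L : ℕ) : ℝ) ^ 2 := by
    have hL : (1 : ℝ) ≤ (F.P K).L := by exact_mod_cast (F.P K).L_pos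
    have hd : (0 : ℝ) ≤ (F.P K).d := Nat.cast_nonneg _
    have hL2 : (0 : ℝ) < α₀ * ((F.P K).L : ℝ) ^ 2 := by positivity
    push_cast
    nlinarith
  exact h2.trans_le h1

/-- `(Lⁱ η_k)² ≤ 1` for `i ≤ k` (`η_k = L^{−k}`, `1 ≤ L`). [folklore] -/
theorem sq_pow_mul_eta_le_one {i k : ℕ} (hi : i ≤ k) : (((F.P K).L : ℝ) ^ i * (F.P K).eta k) ^ 2 ≤ 1 := by
  have hL : (1 : ℝ) ≤ (F.P K).L := by exact_mod_cast (F.P K).L_pos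
  have hLk : (0 : ℝ) < ((F.P K).L : ℝ) ^ k := by positivity
  have h0 : (0 : ℝ) ≤ ((F.P K).L : ℝ) ^ i * (F.P K).eta k := by unfold Params.eta; positivity
  have h1 : ((F.P K).L : ℝ) ^ i * (F.P K).eta k ≤ 1 := by
    unfold Params.eta
    rw [inv_pow, mul_inv_le_iff₀ hLk, one_mul]
    exact pow_le_pow_right₀ hL hi
  exact pow_le_one₀ h0 h1

/-- ★★ **THE (0.4) GUARDS DOWN THE TOWER FROM THE LOCAL [B7] PROPOSITION 2.**  Let `S = (S_i)` be a BOX-CLOSED plaquette family (dag-n11-d: every `p′ ∈ S_{i+1}` has dag-n20-d's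
one-step box `boxRegion (emb p′₋) ((d+4)L + 2)` inside `S_i`), `B = (B_i)` a bond family whose every bond `c ∈ B_{i+1}`, `i + 1 ≤ k`, has the level-`i` plaquettes based in its three
blocks `B(c₋ − e_μ) ∪ B(c₋) ∪ B(c₊)` inside `S_i`, and `U` a configuration with `|U(∂p) − 1| < α₀η_k²` on `S_0`, `C₀(d)α₀ ≤ ⅓`, `2α₀ ≤ c′₂`.  Then the guard `Small ℰp (Ū^i U) c` holds at
every `c ∈ B_{i+1}`, `i + 1 ≤ k`: dag-n11-d's theorem gives `|Ū^i(∂p′) − 1| < 2α₀(Lⁱη_k)² ≤ 2α₀` on `S_i`, and the loop variables of (0.4) at `c` read only the three blocks.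
[cite: Balaban1985Averaging, Prop. 2 (52)–(54) p.26; Balaban1987RG1, (0.4) p.253; Balaban1985Variational, (7) p.279] -/
theorem small_iter_of_plaqSmallOn_boxClosed {k : ℕ} (hk : k ≤ (F.P K).m + (F.P K).K)
    (S : (i : ℕ) → Set (Plaq (F.P K) i))
    (hS : ∀ i, i < k → ∀ p ∈ S (i + 1), (↑(boxRegion (emb p.src) (((F.P K).d + 4) * (F.P K).L + 2)) : Set (Plaq (F.P K) i)) ⊆ S i)
    (B : (i : ℕ) → Set (PBond (F.P K) i))
    (hBS : ∀ (i : ℕ) (c : PBond (F.P K) (i + 1)), i + 1 ≤ k → c ∈ B (i + 1) →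
      ∀ q : Plaq (F.P K) i, (blockOf q.src = c.src.unshift c.dir ∨ blockOf q.src = c.src ∨ blockOf q.src = c.tgt) → q ∈ S i)
    {α₀ : ℝ} (hα : 0 < α₀) (hα3 : (143 * (((((F.P K).d + 4 : ℕ) : ℝ)) ^ 2 / 4) ^ 2) * α₀ ≤ 1 / 3)
    (hα2 : 2 * α₀ ≤ 2 * deltaSU (Fin N) / ((((F.P K).d + 4) * (F.P K).L : ℕ) : ℝ) ^ 2)
    {U : GaugeField (F.P K) 0 (SU N)} (h52 : PlaqSmallOn (S 0) (α₀ * (F.P K).eta k ^ 2) U) :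
    ∀ (i : ℕ) (c : PBond (F.P K) (i + 1)), i + 1 ≤ k → c ∈ B (i + 1) →
      Small (expMeanLogSU (n := Fin N)) (Averaging.iter (avOfRecord F N K) i U) c := by
  intro i c hi hc
  have hP := plaqSmallOn_iter_avOfRecord_of_boxClosed F N K k S hS hα hα3 hα2 h52 (j := i) (Nat.le_of_succ_le hi)
  have hle : 2 * α₀ * (((F.P K).L : ℝ) ^ i * (F.P K).eta k) ^ 2 ≤ 2 * α₀ := by
    have := sq_pow_mul_eta_le_one (F := F) (K := K) (Nat.le_of_succ_le hi)
    nlinarith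
  refine small_of_plaqSmallOn_blocks (expMeanLogSU (n := Fin N)) (δ := 2 * α₀) (by positivity) (hi.trans hk) c
    (fun q hq => (hP q (hBS i c hi hc q hq)).trans_le hle) ?_
  exact stokes_two_mul_lt_deltaSU hα hα2

/-- ★★★ **TOWER CONTINUITY FROM THE FINE PLAQUETTE BOUND (§1 ∘ §3)**: with `S`, `B` as in §3, `B` moreover closed downward under the (0.4) window below `k`, and
`|U₀(∂p) − 1| < α₀η_k²` on `S_0` with the numerics of Prop. 2, every tower variable `U ↦ Ū^i(U)(b)`, `i ≤ k`, `b ∈ B_i`, is continuous at `U₀`.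
[cite: Balaban1985Averaging, Prop. 2 (52)–(54) p.26; Balaban1987RG1, (0.4) p.253; Balaban1985Variational, (2), (7) pp.278–279] -/
theorem continuousAt_iter_apply_of_plaqSmallOn_boxClosed {k : ℕ} (hk : k ≤ (F.P K).m + (F.P K).K)
    (S : (i : ℕ) → Set (Plaq (F.P K) i))
    (hS : ∀ i, i < k → ∀ p ∈ S (i + 1), (↑(boxRegion (emb p.src) (((F.P K).d + 4) * (F.P K).L + 2)) : Set (Plaq (F.P K) i)) ⊆ S i)
    (B : (i : ℕ) → Set (PBond (F.P K) i))
    (hB : ∀ (i : ℕ) (c : PBond (F.P K) (i + 1)), i + 1 ≤ k → c ∈ B (i + 1) →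
      ∀ b : PBond (F.P K) i, (blockOf b.src = c.src ∨ blockOf b.src = c.tgt) → b ∈ B i)
    (hBS : ∀ (i : ℕ) (c : PBond (F.P K) (i + 1)), i + 1 ≤ k → c ∈ B (i + 1) →
      ∀ q : Plaq (F.P K) i, (blockOf q.src = c.src.unshift c.dir ∨ blockOf q.src = c.src ∨ blockOf q.src = c.tgt) → q ∈ S i)
    {α₀ : ℝ} (hα : 0 < α₀) (hα3 : (143 * (((((F.P K).d + 4 : ℕ) : ℝ)) ^ 2 / 4) ^ 2) * α₀ ≤ 1 / 3)
    (hα2 : 2 * α₀ ≤ 2 * deltaSU (Fin N) / ((((F.P K).d + 4) * (F.P K).L : ℕ) : ℝ) ^ 2)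
    {U₀ : GaugeField (F.P K) 0 (SU N)} (h52 : PlaqSmallOn (S 0) (α₀ * (F.P K).eta k ^ 2) U₀)
    {i : ℕ} (hi : i ≤ k) {b : PBond (F.P K) i} (hb : b ∈ B i) :
    ContinuousAt (fun U : GaugeField (F.P K) 0 (SU N) => Averaging.iter (avOfRecord F N K) i U b) U₀ :=
  continuousAt_iter_apply_of_small_on_closedBelow hk B hB (small_iter_of_plaqSmallOn_boxClosed hk S hS B hBS hα hα3 hα2 h52) i hi b hb

end Summit.QuantumFields.YangMills.BalabanUVNodes.N12ClassLetterTowerContinuity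

end
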